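import Summits.PneNP.PneNP.Theorems.PairwiseSAConsistency
import Summits.PneNP.PneNP.Theorems.PstarSAClosureQ
import Summits.PneNP.PneNP.Theorems.PstarSASDPPairs

/-!
# T22.0 — biased BGMT: linear-level Sherali–Adams feasibility from pairwise-independent fibre laws (the hub leaf)

FRONTIER range-avoidance ladder, rung F-N3 context (restricted-model lower bound for the Sherali–Adams hierarchy; cell
`pnp-ideate`, ROUND-22 hub T22.0) — nothing here bears on `P` vs `NP`.

`pairwiseSALinearLevel : PairwiseSALevel.PairwiseSALinearLevel`: for every arity `k ≥ 3` and ratio `a/b > k − 3` there is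
`c > 0` (here `c = 2bK₁ + 2b² + 1`, `K₁ = 1 + 2kb²`) such that a `k`-local map with injective slots that is `(r, a/b)`-boundary
expanding and carries pairwise-independent fibre laws with variable-consistent biases (`PairwiseLaws I y p μ`) has the fibre
of `y` Sherali–Adams feasible at level `r / c`, in the strong form with support threshold `3` (`SAFeasibleAt 3`).

Assembly (Benabbas–Georgiou–Magen–Tulsiani 2012 §§3–4, balance replaced by bias consistency): closure `cl S` from
`PstarSAClosureQ.exists_closureQ` at the intermediate ratio `a₂/b₂ = (a + (k−3)b)/(2b)` (prover-1), laws
`S ↦ PairwiseSA.law I p μ (cl S)` with `law_consistent` / `law_total` / `law_support` (parts I–III), the explicit-family assembly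
`PstarSAPeeling.saProps_of_closure`, and the threshold-`3` support from the closure property on singleton families
(`a₂ ≤ b₂(k−3)` is impossible).  The degenerate ratio `b = 0` (no non-empty family of `≤ r` outputs) is served by the
bias-product law.  `PstarTypedSALinearLevel.typedSALinearLevel` (typed `P⋆`) is the case `k = 4`, `a/b = 3/2`.
-/

set_option linter.dupNamespace false

open Finset Literature.Computability.Complexity
open Summit.PneNP.PneNP.Theorems.PstarPairwise (rho)
open Summit.PneNP.PneNP.Theorems.PstarSALevel (cyl varSet bdry)
open Summit.PneNP.PneNP.Theorems.PstarSASDPLevel (BoundaryExpandingQ)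
open Summit.PneNP.PneNP.Theorems.PairwiseSALevel (PairwiseLaws SAFeasibleAt PairwiseSALinearLevel card_varSet_of_injective)
open Summit.PneNP.PneNP.Theorems.PstarSAClosureQ (exists_closureQ)
open Summit.PneNP.PneNP.Theorems.PstarSAPeeling (saProps_of_closure)

namespace Summit.PneNP.PneNP.Theorems.PairwiseSA

variable {k n m : ℕ}

/-! ## Dominated families are small -/

/-- The boundary of a family of outputs dominated by `S'` lies inside `S'`. -/
theorem bdry_subset_of_subset_dom {I : LocalMap k n m} {S' : Finset (Fin n)} {J : Finset (Fin m)} (hJ : J ⊆ dom I S') :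
    bdry I J ⊆ S' := by
  intro v hv
  obtain ⟨j, hj, hvj⟩ := mem_bdry_iff.1 hv
  exact mem_dom.1 (hJ hj) (priv_subset I J j hvj)

/-- Under `(r, a/b)`-boundary expansion a dominated family of at most `r` outputs has `a·#J ≤ b·#S'`. -/
theorem mul_card_le_of_subset_dom {a b r : ℕ} {I : LocalMap k n m} (hB : BoundaryExpandingQ a b r I) {S' : Finset (Fin n)}
    {J : Finset (Fin m)} (hJ : J ⊆ dom I S') (hr : J.card ≤ r) : a * J.card ≤ b * S'.card :=
  (hB J hr).trans (Nat.mul_le_mul_left b (card_le_card (bdry_subset_of_subset_dom hJ)))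

/-- **Dominated families are small**: if `b·#S' < a·r` then `#dom S' ≤ r` and `a·#dom S' ≤ b·#S'`. -/
theorem card_dom_le {a b r : ℕ} {I : LocalMap k n m} (hB : BoundaryExpandingQ a b r I) {S' : Finset (Fin n)}
    (h : b * S'.card < a * r) : (dom I S').card ≤ r ∧ a * (dom I S').card ≤ b * S'.card := by
  have h1 : (dom I S').card ≤ r := by
    by_contra hlt
    push Not at hlt
    obtain ⟨J, hJ, hJc⟩ := exists_subset_card_eq hlt.le
    have h2 := mul_card_le_of_subset_dom hB hJ hJc.le
    rw [hJc] at h2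
    omega
  exact ⟨h1, mul_card_le_of_subset_dom hB Subset.rfl h1⟩

/-- The boundary of a single output is its variable set. -/
theorem bdry_singleton (I : LocalMap k n m) (j : Fin m) : bdry I {j} = varSet I j := by
  ext v
  unfold PstarSALevel.bdry
  rw [mem_filter, filter_singleton]
  by_cases hv : v ∈ varSet I j
  · simp [hv]
  · simp [hv]

/-! ## The hub theorem -/

/-- **T22.0 — BIASED BGMT (linear-level Sherali–Adams feasibility from pairwise-independent fibre laws).**  For every arity
`k ≥ 3` and ratio `a/b > k − 3` there is `c > 0` such that every `k`-local map with injective slots that is `(r, a/b)`-boundary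
expanding, together with pairwise-independent fibre laws with variable-consistent biases for the system `I(x) = y`, makes the
fibre of `y` Sherali–Adams feasible at level `r / c`, with support threshold `3` (laws supported on the fibre of every output
having at least three variables inside the set).  Restricted-model lower bound for a relaxation hierarchy (cell pnp-ideate,
ROUND-22 hub); it says nothing about `P` versus `NP`. -/
theorem pairwiseSALinearLevel : PairwiseSALinearLevel := by
  intro k a b hk hab
  obtain ⟨d, rfl⟩ := Nat.exists_eq_add_of_le hk
  have hd : 3 + d - 3 = d := by omega
  rw [hd] at hab
  -- constants
  obtain ⟨K₁, hK₁⟩ : ∃ K₁ : ℕ, K₁ = 1 + 2 * (3 + d) * b * b := ⟨_, rfl⟩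
  obtain ⟨c, hc⟩ : ∃ c : ℕ, c = 2 * b * K₁ + 2 * b * b + 1 := ⟨_, rfl⟩
  refine ⟨c, by omega, fun n m r I y p μ hinj hL hB => ?_⟩
  classical
  have hk3 : 3 ≤ 3 + d := by omega
  obtain ⟨t, ht⟩ : ∃ t : ℕ, t = r / c := ⟨_, rfl⟩
  rw [← ht]
  have hct : c * t ≤ r := by rw [ht]; exact Nat.mul_div_le r c
  have ha : 0 < a := by omega
  rcases Nat.eq_zero_or_pos b with hb0 | hb
  · -- degenerate ratio `b = 0`: no output survives a budget `r ≥ 1`, and `r = 0` leaves only `S = ∅`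
    subst hb0
    refine ⟨fun _ => W I p μ ∅, fun S _ => ⟨fun x => W_nonneg hL ∅ x, sum_W_empty I p μ⟩, fun S T _ _ a' => rfl,
      fun S j hS h3 x _ => ?_⟩
    exfalso
    rcases Nat.eq_zero_or_pos r with hr0 | hr
    · have ht0 : t = 0 := by rw [ht, hr0, Nat.zero_div]
      have hS0 : S = ∅ := card_eq_zero.1 (by omega)
      rw [hS0, inter_empty, card_empty] at h3
      omega
    · have h1 := hB {j} (by rw [card_singleton]; exact hr)
      rw [card_singleton, zero_mul] at h1
      omega
  · -- the intermediate ratio `a₂/b₂ = (a + d·b)/(2b)` and the gap `g`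
    obtain ⟨a₂, ha₂⟩ : ∃ a₂ : ℕ, a₂ = a + d * b := ⟨_, rfl⟩
    obtain ⟨b₂, hb₂⟩ : ∃ b₂ : ℕ, b₂ = 2 * b := ⟨_, rfl⟩
    have hdbb : d * b * b < a * b := Nat.mul_lt_mul_of_pos_right hab hb
    have hab₂ : a₂ * b < a * b₂ := by
      rw [ha₂, hb₂]
      nlinarith [hdbb]
    obtain ⟨g, hg⟩ : ∃ g : ℕ, g = a * b₂ - a₂ * b := ⟨_, rfl⟩
    have hg1 : 1 ≤ g := by rw [hg]; omega
    have hb₂pos : 0 < b₂ := by rw [hb₂]; omega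
    -- the closure (BGMT Thm 3.1 at ratio `a₂/b₂`, prover-1's `exists_closureQ`)
    choose cl hsub hclcard hclosed using fun S : Finset (Fin n) => exists_closureQ I a b a₂ b₂ r hab₂ hB S
    simp only [← hg] at hclcard hclosed
    -- closures are small: `#cl S ≤ K₁ · #S`
    have hK : ∀ S : Finset (Fin n), (cl S).card ≤ K₁ * S.card := by
      intro S
      have h1 := hclcard S
      have hX : 1 * (2 * (3 + d) * b * b * S.card) ≤ g * (2 * (3 + d) * b * b * S.card) := Nat.mul_le_mul_right _ hg1
      have h2 : (g + (3 + d) * (b * b₂)) * S.card ≤ g * (K₁ * S.card) :=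
        calc (g + (3 + d) * (b * b₂)) * S.card = g * S.card + 1 * (2 * (3 + d) * b * b * S.card) := by rw [hb₂]; ring
          _ ≤ g * S.card + g * (2 * (3 + d) * b * b * S.card) := by omega
          _ = g * (K₁ * S.card) := by rw [hK₁]; ring
      exact Nat.le_of_mul_le_mul_left (h1.trans h2) (by omega)
    -- the closedness predicate at budget `t`
    let Closed : Finset (Fin n) → Prop := fun S₁ => ∀ M : Finset (Fin m), M.Nonempty →
      (∀ j ∈ M, ¬ varSet I j ⊆ S₁) → g * M.card + b * b₂ * t ≤ g * r → a₂ * M.card ≤ b₂ * (bdry I M \ S₁).card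
    have hClosed : ∀ S : Finset (Fin n), S.card ≤ t → Closed (cl S) := by
      intro S hS M hM hnd hbud
      refine hclosed S M hM hnd (le_trans ?_ hbud)
      have := Nat.mul_le_mul_left (b * b₂) hS
      omega
    -- closedness gives expansion off `S₁` for budgeted non-dominated families
    have hstrict : ∀ {S₁ : Finset (Fin n)} {J : Finset (Fin m)}, Closed S₁ → J.Nonempty →
        (∀ j ∈ J, ¬ varSet I j ⊆ S₁) → g * J.card + b * b₂ * t ≤ g * r → (3 + d - 3) * J.card < (bdry I J \ S₁).card := by
      intro S₁ J hC hne hnd hbud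
      rw [hd]
      have h5 := hC J hne hnd hbud
      have hpos := hne.card_pos
      have hlt : 2 * (d * b) < a₂ := by rw [ha₂]; omega
      have h6 : b₂ * (d * J.card) < b₂ * (bdry I J \ S₁).card :=
        calc b₂ * (d * J.card) = (2 * (d * b)) * J.card := by rw [hb₂]; ring
          _ < a₂ * J.card := Nat.mul_lt_mul_of_pos_right hlt hpos
          _ ≤ b₂ * (bdry I J \ S₁).card := h5
      exact Nat.lt_of_mul_lt_mul_left h6
    -- dominated families of sets within budget `2K₁t` are small (when `t ≥ 1`)
    have hdomB : ∀ {S' : Finset (Fin n)}, S'.card ≤ 2 * K₁ * t → 0 < t →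
        (dom I S').card ≤ r ∧ a * (dom I S').card ≤ b * S'.card := by
      intro S' hS' htpos
      refine card_dom_le hB ?_
      have h1 : b * S'.card ≤ 2 * b * K₁ * t :=
        calc b * S'.card ≤ b * (2 * K₁ * t) := Nat.mul_le_mul_left b hS'
          _ = 2 * b * K₁ * t := by ring
      have h2 : 2 * b * K₁ * t < c * t :=
        Nat.mul_lt_mul_of_pos_right (by rw [hc]; exact Nat.lt_succ_of_le (Nat.le_add_right _ _)) htpos
      have h3 : c * t ≤ a * r := hct.trans (Nat.le_mul_of_pos_left r ha)
      omega
    -- the Sherali–Adams family `S ↦ law (cl S)`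
    obtain ⟨h1, h2, -⟩ := saProps_of_closure I y t (2 * K₁ * t) Closed cl (law I p μ) hsub hClosed
      (fun S hS => by have := hK S; have := Nat.mul_le_mul_left K₁ hS; nlinarith)
      (fun S x => law_nonneg hL S x)
      (fun S' hS' => by
        rcases Nat.eq_zero_or_pos t with ht0 | htpos
        · have hS0 : S' = ∅ := card_eq_zero.1 (by rw [ht0, mul_zero] at hS'; omega)
          subst hS0
          refine law_total hL hinj hk3 ?_
          rw [dom_empty I (by omega)]
          exact expandingOff_empty I ∅
        · exact law_total_of_boundaryExpandingQ hL hinj hk3 (by rw [hd]; exact hab) hB (hdomB hS' htpos).1)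
      (fun S j x hj hx => law_support hL hj hx)
      (fun S₁ S₂ hC h12 hS₂ a' => by
        refine law_consistent hL hinj hk3 h12 ?_ a'
        intro J hJ hne
        rcases Nat.eq_zero_or_pos t with ht0 | htpos
        · exfalso
          have hS0 : S₂ = ∅ := card_eq_zero.1 (by rw [ht0, mul_zero] at hS₂; omega)
          subst hS0
          rw [dom_empty I (by omega), empty_sdiff] at hJ
          exact absurd hne (by rw [subset_empty.1 hJ]; exact not_nonempty_empty)
        · obtain ⟨-, hdom3⟩ := hdomB hS₂ htpos
          have hJc : J.card ≤ (dom I S₂).card := card_le_card (hJ.trans sdiff_subset)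
          have hnd : ∀ j ∈ J, ¬ varSet I j ⊆ S₁ := fun j hj h => (mem_sdiff.1 (hJ hj)).2 (mem_dom.2 h)
          refine hstrict hC hne hnd ?_
          -- the budget: `a·(g·#J + b b₂ t) ≤ a·g·r`
          have e1 : a * (g * J.card) ≤ g * (2 * b * K₁ * t) :=
            calc a * (g * J.card) = g * (a * J.card) := by ring
              _ ≤ g * (a * (dom I S₂).card) := Nat.mul_le_mul_left g (Nat.mul_le_mul_left a hJc)
              _ ≤ g * (b * S₂.card) := Nat.mul_le_mul_left g hdom3
              _ ≤ g * (b * (2 * K₁ * t)) := Nat.mul_le_mul_left g (Nat.mul_le_mul_left b hS₂)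
              _ = g * (2 * b * K₁ * t) := by ring
          have e2 : g * (2 * b * K₁) ≤ a * (g * (2 * b * K₁)) := Nat.le_mul_of_pos_left _ ha
          have e3 : 2 * a * b * b ≤ g * (2 * a * b * b) := Nat.le_mul_of_pos_left _ hg1
          have e4 : a * (g * J.card + b * b₂ * t) ≤ a * (g * r) :=
            calc a * (g * J.card + b * b₂ * t) = a * (g * J.card) + 2 * a * b * b * t := by rw [hb₂]; ring
              _ ≤ g * (2 * b * K₁ * t) + 2 * a * b * b * t := by omega
              _ = (g * (2 * b * K₁) + 2 * a * b * b) * t := by ring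
              _ ≤ (a * (g * (2 * b * K₁)) + g * (2 * a * b * b)) * t := Nat.mul_le_mul_right t (add_le_add e2 e3)
              _ = a * g * (2 * b * K₁ + 2 * b * b) * t := by ring
              _ ≤ a * g * c * t := by
                  refine Nat.mul_le_mul_right t (Nat.mul_le_mul_left (a * g) ?_)
                  rw [hc]; omega
              _ = a * (g * (c * t)) := by ring
              _ ≤ a * (g * r) := Nat.mul_le_mul_left a (Nat.mul_le_mul_left g hct)
          exact Nat.le_of_mul_le_mul_left e4 ha)
    refine ⟨fun S => law I p μ (cl S), h1, h2, fun S j hS h3 x hx => law_support hL ?_ hx⟩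
    -- threshold-`3` support: an output with three variables in `S` is dominated by `cl S`
    by_contra hnd
    have hr : 0 < r := by
      by_contra hr0
      have ht0 : t = 0 := by rw [ht]; exact Nat.div_eq_of_lt (by omega)
      have hS0 : S = ∅ := card_eq_zero.1 (by omega)
      rw [hS0, inter_empty, card_empty] at h3
      omega
    have hbud : g * ({j} : Finset (Fin m)).card + b * b₂ * t ≤ g * r := by
      rw [card_singleton, mul_one]
      rcases Nat.eq_zero_or_pos t with ht0 | htpos
      · rw [ht0, mul_zero, add_zero]
        exact Nat.le_mul_of_pos_right g hr
      · calc g + b * b₂ * t = g + 2 * b * b * t := by rw [hb₂]; ring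
          _ ≤ g * t + g * (2 * b * b * t) := add_le_add (Nat.le_mul_of_pos_right g htpos) (Nat.le_mul_of_pos_left _ hg1)
          _ = g * ((2 * b * b + 1) * t) := by ring
          _ ≤ g * (c * t) := Nat.mul_le_mul_left g (Nat.mul_le_mul_right t (by rw [hc]; omega))
          _ ≤ g * r := Nat.mul_le_mul_left g hct
    have h5 := hClosed S hS {j} (singleton_nonempty j) (fun j' hj' => by rw [mem_singleton.1 hj']; exact hnd) hbud
    rw [card_singleton, mul_one, bdry_singleton] at h5
    -- `#(varSet j \ cl S) ≤ k − 3`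
    have hsub3 : (varSet I j \ cl S).card + 3 ≤ 3 + d := by
      have h6 : varSet I j \ cl S ⊆ varSet I j \ S := sdiff_subset_sdiff Subset.rfl (hsub S)
      have h7 := card_le_card h6
      have h8 := card_sdiff_add_card_inter (varSet I j) S
      rw [card_varSet_of_injective I (hinj j)] at h8
      omega
    have h9 : b₂ * (varSet I j \ cl S).card ≤ b₂ * d := Nat.mul_le_mul_left b₂ (by omega)
    have h10 : b₂ * d = 2 * (d * b) := by rw [hb₂]; ring
    omega

end Summit.PneNP.PneNP.Theorems.PairwiseSA
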